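import Literature.NumberTheory.ComplexMultiplication.CMTypeRankCommonConstituent
import HarnessLib

/-!
# Three fixed-vector criteria for the absence of common constituents between two slots of a family of CM types

Companion of `NumberTheory/ComplexMultiplication/CMTypeRankCommonConstituent` (setting: a group `G` acting slot by
slot on `⊔_i E_i` = Deligne's `Hom(∏_i K_i, ℂ)`, CM types `Φ_i ⊆ E_i`, Shimura's antisymmetric spans
`U(Φ_i) = antiSpan G (Φ_i)`; two slots `i, j` have NO COMMON CONSTITUENT when every `G`-stable `P ≤ U(Φ_i)` carrying
a linear `T : ℚ^{E_i} → ℚ^{E_j}`, equivariant and injective on `P`, with `T(P) ≤ U(Φ_j)`, is zero; pairwise absence of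
common constituents gives `U(Σ) = ⊕_i U(Φ_i)`, i.e. `Hg(∏_i A_i) = ∏_i Hg(A_i)`), of `…/CMTypeRankIrreducibleSlot` (an
irreducible slot against a smaller or reducible one) and of `…/CMTypeRankPartitionSlots` (slots of different blocks).
The criteria there (`pairwise_of_partialConj`, `pairwise_of_eigenvector`, `pairwise_of_irreducible_of_finrank_le`) do
not separate two slots whose modules are irreducible OF THE SAME DIMENSION, nor two reducible slots without a partial
conjugation — the situations of two sextic CM fields with entangled Galois closures.  Three further sufficient
conditions, each in both orders at once, all by chasing FIXED VECTORS through an equivariant injection: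

* `pairwise_of_irreducible_of_smul_eq` — (κ) **an irreducible slot moved by an element fixing the other slot**: if
  `U(Φ_i)` is irreducible (no `G`-stable subspace other than `0` and itself) and some `g ∈ G` fixes `E_j` pointwise but
  moves some vector of `U(Φ_i)`, then `i, j` have no common constituent.  (For CM fields: `Φ_i` nondegenerate with
  `U(Φ_i)` irreducible and the Galois closure of `K_i` NOT contained in that of `K_j`.)
* `pairwise_of_fixed_subset_eigenline` — (λ) **fixed vectors in an eigenline**: if `S ⊆ G` fixes `E_j` pointwise, every
  `S`-fixed vector of `U(Φ_i)` is a `χ`-eigenvector (`f ∘ g = χ(g) f` for all `g ∈ G`), and `U(Φ_j)` has no non-zero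
  `χ`-eigenvector, then `i, j` have no common constituent.  (For a sextic CM field `K_i ⊇ k` imaginary quadratic,
  `S = Aut(ℂ/L_j)`: the `S`-fixed odd weights are multiples of the sign vector of `k` as soon as `K_i ⊄ L_j`, and `U(Φ_j)`
  has no `χ_k`-eigenvector as soon as `k ⊄ K_j`.)
* `pairwise_of_irreducible_of_fixed` — (δ) **a fixed vector on the irreducible side only**: if `U(Φ_i)` is irreducible
  and contains a non-zero vector fixed by every element of `S ⊆ G`, while `U(Φ_j)` contains none, then `i, j` have no
  common constituent.  (Twin sextic CM fields `K`, `K'` in one Galois closure of degree `48`: `S = Aut(ℂ/y(K'))`.)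

PROOFS.  An equivariant `T` injective on a stable `P` transports the relations `f ∘ g = f` and `f ∘ g = χ(g) f` in both
directions between `f ∈ P` and `T f` (`T (f ∘ g − f) = (T f) ∘ g − T f`); an element fixing `E_j` pointwise fixes every
weight on `E_j`; a non-zero stable subspace of an irreducible `U(Φ_i)`, or the image of a non-zero stable subspace
under an equivariant injection into it, is all of `U(Φ_i)`.  Finite-dimensional linear algebra over `ℚ`; theorems only,
no definition, no named fact, no `sorry`.  On Hodge groups ([Deligne1982HodgeCycles] I Ex. 3.7 (c)): three ways to see
that the character modules of `Hg(A_i)` and `Hg(A_j)` share no simple factor.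

## References
* [Gordon1999HodgeAVSurvey] B. B. Gordon, *A survey of the Hodge conjecture for abelian varieties*, §3 Theorem (Imai,
  Murty) with proof; 7.5–7.7.
* [Serre1977] J.-P. Serre, *Linear Representations of Finite Groups*, GTM 42, §2.2 (Schur's lemma).
* [Deligne1982HodgeCycles] P. Deligne, *Hodge cycles on abelian varieties*, LNM 900 (1982), I Ex. 3.7.
-/

set_option autoImplicit false

noncomputable section

namespace Literature.NumberTheory.ComplexMultiplication

variable {G : Type*} [Group G] {I : Type*} {E : I → Type*} [∀ i, MulAction G (E i)]

/-! ### Transport of relations along an equivariant injection -/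

section Transport

variable {X Y : Type*} [MulAction G X] [MulAction G Y]

/-- If `T` is equivariant and injective on the stable `P ∋ f` and `T f` is fixed by `g`, then `f` is fixed by `g`.
[cite: Serre1977, §2.2] -/
private theorem comp_smul_eq_self_of_apply {P : Submodule ℚ (X → ℚ)}
    (hPst : ∀ g : G, ∀ f ∈ P, (fun x => f (g • x)) ∈ P) {T : (X → ℚ) →ₗ[ℚ] (Y → ℚ)}
    (hT : ∀ g : G, ∀ f ∈ P, T (fun x => f (g • x)) = fun y => T f (g • y)) (hTinj : ∀ f ∈ P, T f = 0 → f = 0)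
    {f : X → ℚ} (hf : f ∈ P) {g : G} (hg : (fun y => T f (g • y)) = T f) : (fun x => f (g • x)) = f := by
  have h1 : T ((fun x => f (g • x)) - f) = 0 := by rw [map_sub, hT g f hf, hg, sub_self]
  exact sub_eq_zero.1 (hTinj _ (P.sub_mem (hPst g f hf) hf) h1)

/-- If `T` is equivariant and injective on the stable `P ∋ f` and `T f` is a `χ`-eigenvector, then so is `f`.
[cite: Serre1977, §2.2] -/
private theorem comp_smul_eq_smul_of_apply {P : Submodule ℚ (X → ℚ)}
    (hPst : ∀ g : G, ∀ f ∈ P, (fun x => f (g • x)) ∈ P) {T : (X → ℚ) →ₗ[ℚ] (Y → ℚ)}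
    (hT : ∀ g : G, ∀ f ∈ P, T (fun x => f (g • x)) = fun y => T f (g • y)) (hTinj : ∀ f ∈ P, T f = 0 → f = 0)
    {f : X → ℚ} (hf : f ∈ P) (χ : G → ℚ) (hg : ∀ g : G, (fun y => T f (g • y)) = χ g • T f) (g : G) :
    (fun x => f (g • x)) = χ g • f := by
  have h1 : T ((fun x => f (g • x)) - χ g • f) = 0 := by rw [map_sub, map_smul, hT g f hf, hg g, sub_self]
  exact sub_eq_zero.1 (hTinj _ (P.sub_mem (hPst g f hf) (P.smul_mem _ hf)) h1)

/-- An element fixing `Y` pointwise fixes every weight on `Y`. [folklore] -/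
private theorem comp_smul_eq_self_of_forall_smul_eq {g : G} (hg : ∀ y : Y, g • y = y) (f : Y → ℚ) :
    (fun y => f (g • y)) = f := by
  funext y
  rw [hg y]

/-- The image of a stable subspace under a map equivariant on it is stable. [cite: Serre1977, §2.2] -/
private theorem map_stable {P : Submodule ℚ (X → ℚ)} (hPst : ∀ g : G, ∀ f ∈ P, (fun x => f (g • x)) ∈ P)
    {T : (X → ℚ) →ₗ[ℚ] (Y → ℚ)} (hT : ∀ g : G, ∀ f ∈ P, T (fun x => f (g • x)) = fun y => T f (g • y))
    (k : G) (f' : Y → ℚ) (hf' : f' ∈ P.map T) : (fun y => f' (k • y)) ∈ P.map T := by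
  obtain ⟨f, hf, rfl⟩ := hf'
  exact ⟨fun x => f (k • x), hPst k f hf, hT k f hf⟩

/-- The image of a non-zero subspace under a map injective on it is non-zero. [folklore] -/
private theorem map_ne_bot {P : Submodule ℚ (X → ℚ)} (hP : P ≠ ⊥) {T : (X → ℚ) →ₗ[ℚ] (Y → ℚ)}
    (hTinj : ∀ f ∈ P, T f = 0 → f = 0) : P.map T ≠ ⊥ := by
  obtain ⟨f, hf, hf0⟩ := (Submodule.ne_bot_iff P).1 hP
  exact (Submodule.ne_bot_iff _).2 ⟨T f, ⟨f, hf, rfl⟩, fun h => hf0 (hTinj f hf h)⟩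

end Transport

/-! ### (κ) An irreducible slot moved by an element fixing the other slot -/

section Kappa

/-- **(κ) An irreducible slot moved by an element that fixes the other slot pointwise shares no constituent with it, in
both orders.**  If `U(Φ_i)` has no `G`-stable subspace other than `0` and itself, and some `g ∈ G` satisfies `g • s = s`
for all `s ∈ E_j` while `f ∘ g ≠ f` for some `f ∈ U(Φ_i)`, then every stable `P ≤ U(Φ_i)` with an equivariant
injection into `U(Φ_j)` is zero (it would be all of `U(Φ_i)`, on which `g` acts trivially through `T`), and every
stable `P ≤ U(Φ_j)` with an equivariant injection into `U(Φ_i)` is zero (its image would be all of `U(Φ_i)`, fixed by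
`g`).  For `E_i = Hom(K_i, ℂ)`: the kernel of the action on an irreducible character module is the subgroup fixing the
Galois closure; different kernels, no common simple factor. [cite: Serre1977, §2.2] [cite: Gordon1999HodgeAVSurvey, §3 Theorem (proof)] -/
theorem pairwise_of_irreducible_of_smul_eq {Φ : ∀ i, Set (E i)} {i j : I}
    (hirr : ∀ W : Submodule ℚ (E i → ℚ), W ≤ antiSpan G (Φ i) → W ≠ ⊥ →
      (∀ (k : G) (f : E i → ℚ), f ∈ W → (fun y => f (k • y)) ∈ W) → W = antiSpan G (Φ i))
    {g : G} (hgj : ∀ s : E j, g • s = s) (hgi : ∃ f ∈ antiSpan G (Φ i), (fun x => f (g • x)) ≠ f) :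
    (∀ P : Submodule ℚ (E i → ℚ), P ≤ antiSpan G (Φ i) →
      (∀ g : G, ∀ f ∈ P, (fun x => f (g • x)) ∈ P) →
      ∀ T : (E i → ℚ) →ₗ[ℚ] (E j → ℚ),
        (∀ g : G, ∀ f ∈ P, T (fun x => f (g • x)) = fun y => T f (g • y)) →
        (∀ f ∈ P, T f ∈ antiSpan G (Φ j)) → (∀ f ∈ P, T f = 0 → f = 0) → P = ⊥) ∧
    (∀ P : Submodule ℚ (E j → ℚ), P ≤ antiSpan G (Φ j) →
      (∀ g : G, ∀ f ∈ P, (fun x => f (g • x)) ∈ P) →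
      ∀ T : (E j → ℚ) →ₗ[ℚ] (E i → ℚ),
        (∀ g : G, ∀ f ∈ P, T (fun x => f (g • x)) = fun y => T f (g • y)) →
        (∀ f ∈ P, T f ∈ antiSpan G (Φ i)) → (∀ f ∈ P, T f = 0 → f = 0) → P = ⊥) := by
  obtain ⟨f₀, hf₀U, hf₀g⟩ := hgi
  constructor
  · intro P hP hPst T hT _ hTinj
    by_contra hP0
    have hPU : P = antiSpan G (Φ i) := hirr P hP hP0 (fun k f hf => hPst k f hf)
    have hf₀P : f₀ ∈ P := hPU ▸ hf₀U
    exact hf₀g (comp_smul_eq_self_of_apply hPst hT hTinj hf₀P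
      (comp_smul_eq_self_of_forall_smul_eq hgj (T f₀)))
  · intro P _ hPst T hT hTU hTinj
    by_contra hP0
    have hTP : P.map T = antiSpan G (Φ i) :=
      hirr (P.map T) (by rintro _ ⟨f, hf, rfl⟩; exact hTU f hf) (map_ne_bot hP0 hTinj) (map_stable hPst hT)
    have hf₀TP : f₀ ∈ P.map T := hTP ▸ hf₀U
    obtain ⟨f, hf, rfl⟩ := hf₀TP
    apply hf₀g
    rw [← hT g f hf, comp_smul_eq_self_of_forall_smul_eq hgj f]

end Kappa

/-! ### (λ) Fixed vectors inside an eigenline -/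

section Lambda

/-- **(λ) Fixed vectors in an eigenline against a slot without that eigenvector, in both orders.**  Let `S ⊆ G` fix
`E_j` pointwise.  Suppose every vector of `U(Φ_i)` fixed by all of `S` is a `χ`-eigenvector (`f ∘ g = χ(g) f` for every
`g ∈ G`), and `U(Φ_j)` contains no non-zero `χ`-eigenvector.  Then every stable `P ≤ U(Φ_i)` with an equivariant
injection `T` into `U(Φ_j)` is zero (`T f` is `S`-fixed, hence `f` is, hence `f` and `T f` are `χ`-eigenvectors), and
every stable `P ≤ U(Φ_j)` with an equivariant injection into `U(Φ_i)` is zero (`T f` is `S`-fixed, hence a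
`χ`-eigenvector, hence so is `f`). [cite: Serre1977, §2.2] [cite: Gordon1999HodgeAVSurvey, §3 Theorem (proof)] -/
theorem pairwise_of_fixed_subset_eigenline {Φ : ∀ i, Set (E i)} {i j : I} (S : Set G) (χ : G → ℚ)
    (hSj : ∀ g ∈ S, ∀ s : E j, g • s = s)
    (hfix : ∀ f ∈ antiSpan G (Φ i), (∀ g ∈ S, (fun x => f (g • x)) = f) →
      ∀ g : G, (fun x => f (g • x)) = χ g • f)
    (hUj : ∀ f ∈ antiSpan G (Φ j), (∀ g : G, (fun x => f (g • x)) = χ g • f) → f = 0) :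
    (∀ P : Submodule ℚ (E i → ℚ), P ≤ antiSpan G (Φ i) →
      (∀ g : G, ∀ f ∈ P, (fun x => f (g • x)) ∈ P) →
      ∀ T : (E i → ℚ) →ₗ[ℚ] (E j → ℚ),
        (∀ g : G, ∀ f ∈ P, T (fun x => f (g • x)) = fun y => T f (g • y)) →
        (∀ f ∈ P, T f ∈ antiSpan G (Φ j)) → (∀ f ∈ P, T f = 0 → f = 0) → P = ⊥) ∧
    (∀ P : Submodule ℚ (E j → ℚ), P ≤ antiSpan G (Φ j) →
      (∀ g : G, ∀ f ∈ P, (fun x => f (g • x)) ∈ P) →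
      ∀ T : (E j → ℚ) →ₗ[ℚ] (E i → ℚ),
        (∀ g : G, ∀ f ∈ P, T (fun x => f (g • x)) = fun y => T f (g • y)) →
        (∀ f ∈ P, T f ∈ antiSpan G (Φ i)) → (∀ f ∈ P, T f = 0 → f = 0) → P = ⊥) := by
  constructor
  · intro P hP hPst T hT hTU hTinj
    refine (Submodule.eq_bot_iff P).2 fun f hf => hTinj f hf (hUj (T f) (hTU f hf) fun g => ?_)
    -- `f` is `S`-fixed, hence a `χ`-eigenvector, hence so is `T f`
    have hfS : ∀ g ∈ S, (fun x => f (g • x)) = f := fun g hg =>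
      comp_smul_eq_self_of_apply hPst hT hTinj hf (comp_smul_eq_self_of_forall_smul_eq (hSj g hg) (T f))
    rw [← hT g f hf, hfix f (hP hf) hfS g, map_smul]
  · intro P hP hPst T hT hTU hTinj
    refine (Submodule.eq_bot_iff P).2 fun f hf => hUj f (hP hf) fun g => ?_
    -- `T f` is `S`-fixed, hence a `χ`-eigenvector, hence so is `f`
    have hTfS : ∀ g ∈ S, (fun x => T f (g • x)) = T f := fun g hg => by
      rw [← hT g f hf, comp_smul_eq_self_of_forall_smul_eq (hSj g hg) f]
    exact comp_smul_eq_smul_of_apply hPst hT hTinj hf χ (hfix (T f) (hTU f hf) hTfS) g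

end Lambda

/-! ### (δ) A fixed vector on the irreducible side only -/

section Delta

/-- **(δ) An irreducible slot with a vector fixed by `S` against a slot without one, in both orders.**  If `U(Φ_i)` has
no `G`-stable subspace other than `0` and itself and contains a non-zero vector fixed by every element of `S ⊆ G`, while
`U(Φ_j)` contains no non-zero vector fixed by all of `S`, then every stable `P ≤ U(Φ_i)` with an equivariant injection
`T` into `U(Φ_j)` is zero (`P` would be `U(Φ_i)`, and `T` of the fixed vector is fixed), and every stable `P ≤ U(Φ_j)`
with an equivariant injection into `U(Φ_i)` is zero (its image would be `U(Φ_i)`; the preimage of the fixed vector is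
fixed).  Dimensions of fixed subspaces are invariants of a module; here only `0` versus `≠ 0` is used.
[cite: Serre1977, §2.2] [cite: Gordon1999HodgeAVSurvey, §3 Theorem (proof)] -/
theorem pairwise_of_irreducible_of_fixed {Φ : ∀ i, Set (E i)} {i j : I} (S : Set G)
    (hirr : ∀ W : Submodule ℚ (E i → ℚ), W ≤ antiSpan G (Φ i) → W ≠ ⊥ →
      (∀ (k : G) (f : E i → ℚ), f ∈ W → (fun y => f (k • y)) ∈ W) → W = antiSpan G (Φ i))
    (hfi : ∃ f ∈ antiSpan G (Φ i), f ≠ 0 ∧ ∀ g ∈ S, (fun x => f (g • x)) = f)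
    (hfj : ∀ f ∈ antiSpan G (Φ j), (∀ g ∈ S, (fun x => f (g • x)) = f) → f = 0) :
    (∀ P : Submodule ℚ (E i → ℚ), P ≤ antiSpan G (Φ i) →
      (∀ g : G, ∀ f ∈ P, (fun x => f (g • x)) ∈ P) →
      ∀ T : (E i → ℚ) →ₗ[ℚ] (E j → ℚ),
        (∀ g : G, ∀ f ∈ P, T (fun x => f (g • x)) = fun y => T f (g • y)) →
        (∀ f ∈ P, T f ∈ antiSpan G (Φ j)) → (∀ f ∈ P, T f = 0 → f = 0) → P = ⊥) ∧
    (∀ P : Submodule ℚ (E j → ℚ), P ≤ antiSpan G (Φ j) →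
      (∀ g : G, ∀ f ∈ P, (fun x => f (g • x)) ∈ P) →
      ∀ T : (E j → ℚ) →ₗ[ℚ] (E i → ℚ),
        (∀ g : G, ∀ f ∈ P, T (fun x => f (g • x)) = fun y => T f (g • y)) →
        (∀ f ∈ P, T f ∈ antiSpan G (Φ i)) → (∀ f ∈ P, T f = 0 → f = 0) → P = ⊥) := by
  obtain ⟨f₀, hf₀U, hf₀0, hf₀S⟩ := hfi
  constructor
  · intro P hP hPst T hT hTU hTinj
    by_contra hP0
    have hPU : P = antiSpan G (Φ i) := hirr P hP hP0 (fun k f hf => hPst k f hf)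
    have hf₀P : f₀ ∈ P := hPU ▸ hf₀U
    refine hf₀0 (hTinj f₀ hf₀P (hfj (T f₀) (hTU f₀ hf₀P) fun g hg => ?_))
    rw [← hT g f₀ hf₀P, hf₀S g hg]
  · intro P hP hPst T hT hTU hTinj
    by_contra hP0
    have hTP : P.map T = antiSpan G (Φ i) :=
      hirr (P.map T) (by rintro _ ⟨f, hf, rfl⟩; exact hTU f hf) (map_ne_bot hP0 hTinj) (map_stable hPst hT)
    have hf₀TP : f₀ ∈ P.map T := hTP ▸ hf₀U
    obtain ⟨f, hf, rfl⟩ := hf₀TP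
    have hf0 : f = 0 := hfj f (hP hf) fun g hg => comp_smul_eq_self_of_apply hPst hT hTinj hf (hf₀S g hg)
    exact hf₀0 (by rw [hf0, map_zero])

end Delta

end Literature.NumberTheory.ComplexMultiplication

end
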